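import Mathlib.MeasureTheory.Integral.Bochner.ContinuousLinearMap
import Mathlib.Analysis.SpecialFunctions.Trigonometric.Basic
import Mathlib.Analysis.Complex.Trigonometric

/-!
# T⁴ programme, spine node NE1′ (O3b/H2), COUPLING LINE — QUASI-POSITIVITY UNDER A BOUNDED LOCAL PHASE: the abstract core of
# road P3's proposal for the merged road's single own-open insertion lemma (P3 (α) ≡ P4 IL) on the «locally complex data» route
# (skeleton `t4/skeletons/NE1p-t4-ne1p-p3.md` v0.12 §3d)

Cell `pub-balaban`, unit `b2b-balaban-t4-ne1p-p3` (ROUND-2 technique-distinct prover #3 on BINDER row NE1′, technique «coupling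
of block-spin towers … bound the difference pathwise via the printed analyticity radii»), generation 31.  OUR elementary lemmas
(new work ⇒ `Summits/`), Mathlib only; everything is PROVED; nothing is a `def` (the phase factor `e^{−iψ}` is written out as `exp (−ψ·I)`); nothing of T. Bałaban's series is
asserted.  Companions: `Support/NE1pPathwiseBlock` (p209631/p210137: line-Schwarz, one-block bound, covariance off the real axis),
road P4's `Support/CovariantMeanRecursion` / `CovariantMeanDepth` (p209931/p210336).

THE POINT (skeleton §3d).  In the Schwarz step of the pathwise route (and of road P4's depth lemma DL) the complex line perturbs
the block DATA only LOCALLY — on the support of the functional being bounded — so the «complex data» at which the insertion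
lemma is needed are REAL outside a bounded region (up to the exponentially decaying response of the background).  For such data
the undressed small-field fluctuation integral (printed structure: [Balaban1988Convergent] (3.15)/(3.25) p. 267/270 with the
fluctuation cut-offs (3.16) p. 268 on a FIXED real region after the linearising change of variables) has weight `e^{−S_V(A′)}`
with `|e^{−S_V}| = e^{−Re S_V}` a POSITIVE weight and a PHASE `ψ(A′) = Im(S_V(A′) − S_V(0))` that vanishes for real data and is
bounded, for locally complex data, by a LOCAL TOTAL PHASE `Θ` = (number of local terms whose data- or background-dependence
meets the complex region, with exponential tails) × (per-term size of the FLUCTUATION-DEPENDENT part of the term at complex data)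
— per-term factors of printed TYPE: the background dependence of the fluctuation covariance [Balaban1985PropagatorsBackground],
the old action's fluctuation-dependence factor («the additional factor O(ε_k) arising from the bound of the fluctuation field»,
[Balaban1988Convergent] p. 277; the cell reads it as `ρ_k = O((log g_k⁻²)^{p₀−q₁})`, SMALLNESS S-B14.35 (X13) — a RECONSTRUCTION),
the exponential decay of the minimiser's response [Balaban1985Variational] (190) — all of which tend to `0` with the coupling for
a FIXED local geometry because the printed radii (2.28) p. 259 are proportional to `g_j`.  THEN NO CLUSTER EXPANSION IS NEEDED
for the BOUND: the normalised complex expectation of a bounded insertion is at most `sup‖Φ‖ / cos Θ` (this file), its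
denominator does not vanish (this file), and its analyticity in the local complex data is that of a finite-dimensional parametric
integral over a fixed region.  What this does NOT do (HONEST): for a LARGE-FIELD (ℝ-) operation the integrated variables are not
cut off near zero, the per-term factor is `O(1)`, `Θ` is extensive in the component and `cos Θ` is meaningless — that is the
WALL's birth number `Q(Λ)` (GAPS G-adv3-21), untouched here; and the per-term bounds that make `Θ` small are printed-TYPE inputs,
hypotheses of any instantiation, asserted of no datum (ABSOLUTE RULE).

HONEST FRAMING (T4-DAG p. 1).  Rung (B)+1 on ONE finite four-torus of fixed physical size; NOT infinite volume, NOT a mass gap,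
NOT the Clay problem, NOT summit progress.  NE1′ is NOT printed and NOT proved (spine 0/9).  HONEST DEPENDENCY (verbatim):
continuum YM on T⁴ ⇐ BetaPertH ∧ nine spine estimates (0/9 proved); BetaPertH ⇐ (D1) ∧ (D4) ∧ CAP+tail; G-an2-4 gates asym, D1
and NE2/3/4.

CITATION HEADER.  No page of the series is quoted as a hypothesis-free input; the locators above were READ this generation on the
corpus text layer `paper:balaban1988-cmp119-convergent-renormalization` (PDF pp. 25–29, 34–35 = journal pp. 267–271, 276–277).

WHAT IS PROVED ([folklore], Mathlib only).  For a finite measure `μ` (reading: `e^{−Re S_V(A′)}dA′` on the cut-off region), a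
real phase function `ψ` with `|ψ| ≤ Θ` a.e., `0 ≤ Θ < π/2`, and an insertion `Φ` with `‖Φ‖ ≤ N` a.e.:
* `norm_integral_phase_smul_le` — `‖∫ e^{−iψ}•Φ dμ‖ ≤ N·μ(univ)`;
* `cos_mul_measure_le_re_integral_phase` / `cos_mul_measure_le_norm_integral_phase` — `cos Θ·μ(univ) ≤ Re ∫e^{−iψ}dμ ≤ ‖∫e^{−iψ}dμ‖`;
* `integral_phase_ne_zero` — the denominator does not vanish when `μ ≠ 0`;
* `norm_integral_phase_smul_le_div_mul` — QUASI-POSITIVITY: `‖∫e^{−iψ}•Φ dμ‖ ≤ (N / cos Θ)·‖∫e^{−iψ}dμ‖`;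
* `norm_phaseMean_le` — the normalised form `‖(∫e^{−iψ}dμ)⁻¹ • ∫e^{−iψ}•Φ dμ‖ ≤ N / cos Θ`, i.e. `C_ins ≤ 1/cos Θ` (`≤ √2` at
  `Θ ≤ π/4`).
v1.1 (same seat, same generation; v1 declarations byte-identical, §2 APPENDED) — MOMENT BOOKING (answer to the synthesis seat's
Q-p34-loc-1 (ii), skeleton v0.12.1): the pathwise route is NOT inherently sup-booked.  The Schwarz step is applied pathwise on a disc
whose radius depends on the ACTUAL configuration (the fluctuation cut-off enters only as CONTAINMENT), giving a pointwise bound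
`‖Φ x‖ ≤ (N/R₁)·D x`; averaging it against the positive weight books the FIRST MOMENT of the displacement `D`:
* `norm_integral_phase_smul_le_integral_norm` — `‖∫e^{−iψ}•Φ dμ‖ ≤ ∫‖Φ‖dμ`;
* `norm_integral_phase_smul_le_of_pointwise` — `‖Φ‖ ≤ (N/R₁)·D` a.e. ⇒ `‖∫e^{−iψ}•Φ dμ‖ ≤ (N/R₁)·∫D dμ`;
* `norm_phaseMean_le_moment` — `‖(∫e^{−iψ}dμ)⁻¹ • ∫e^{−iψ}•Φ dμ‖ ≤ (1/cos Θ)·(N/R₁)·(∫D dμ / μ(univ))` — the fluctuation third of the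
  per-step rate carries `E_μ[D]` (a first moment of the fluctuation, `O(g_j)` by a Gaussian-type moment bound of printed TYPE) instead
  of the polylog cut-off `δ_j = g_jA₁(log g_j⁻²)^{p₀}`: the exponent premise «`q₀ ≥ p₀ + 1` / `C₀` large» of the sup booking DISAPPEARS
  (only the containment `δ_j < c₁α_{0,j}/8` = the cell's (X12)-type clause and the printed `q₀ ≥ 2` of (2.28) remain).
-/

noncomputable section

open MeasureTheory Complex Set
open scoped Real

namespace Summit.QuantumFields.BalabanUV.T4Continuum.NE1pLocalPhase

section Phase

variable {Ω : Type*}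

/-- `‖e^{−iψ}‖ = 1`. [folklore] -/
theorem norm_phase (ψ : Ω → ℝ) (ω : Ω) : ‖exp (-(ψ ω : ℂ) * I)‖ = 1 := by
  have : -(ψ ω : ℂ) * I = ((-ψ ω : ℝ) : ℂ) * I := by push_cast; ring
  rw [this, norm_exp_ofReal_mul_I]

/-- `Re e^{−iψ} = cos ψ`. [folklore] -/
theorem re_phase (ψ : Ω → ℝ) (ω : Ω) : (exp (-(ψ ω : ℂ) * I)).re = Real.cos (ψ ω) := by
  have : -(ψ ω : ℂ) * I = ((-ψ ω : ℝ) : ℂ) * I := by push_cast; ring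
  rw [this, exp_ofReal_mul_I_re, Real.cos_neg]

/-- Measurability of the phase factor from measurability of `ψ`. [folklore] -/
theorem measurable_phase [MeasurableSpace Ω] {ψ : Ω → ℝ} (hψ : Measurable ψ) : Measurable (fun ω => exp (-(ψ ω : ℂ) * I)) := by
  fun_prop

end Phase

variable {Ω : Type*} [MeasurableSpace Ω] {μ : Measure Ω} [IsFiniteMeasure μ]
variable {F : Type*} [NormedAddCommGroup F] [NormedSpace ℂ F]

/-- The phase factor is integrable against a finite measure. [folklore] -/
theorem integrable_phase {ψ : Ω → ℝ} (hψ : Measurable ψ) : Integrable (fun ω => exp (-(ψ ω : ℂ) * I)) μ :=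
  (integrable_const (1 : ℝ)).mono' (measurable_phase hψ).aestronglyMeasurable
    (Filter.Eventually.of_forall fun ω => (norm_phase ψ ω).le)

/-- **NUMERATOR.**  `‖∫ e^{−iψ}•Φ dμ‖ ≤ N·μ(univ)` when `‖Φ‖ ≤ N` a.e. [folklore] -/
theorem norm_integral_phase_smul_le {ψ : Ω → ℝ} {Φ : Ω → F} {N : ℝ} (hΦ : ∀ᵐ ω ∂μ, ‖Φ ω‖ ≤ N) :
    ‖∫ ω, exp (-(ψ ω : ℂ) * I) • Φ ω ∂μ‖ ≤ N * μ.real univ := by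
  refine norm_integral_le_of_norm_le_const ?_
  filter_upwards [hΦ] with ω hω
  rw [norm_smul, norm_phase, one_mul]
  exact hω

/-- **DENOMINATOR, real part.**  `cos Θ·μ(univ) ≤ Re ∫ e^{−iψ} dμ` when `|ψ| ≤ Θ ≤ π/2` a.e. [folklore] -/
theorem cos_mul_measure_le_re_integral_phase {ψ : Ω → ℝ} {Θ : ℝ} (hψm : Measurable ψ) (hΘ : Θ ≤ π / 2)
    (hψ : ∀ᵐ ω ∂μ, |ψ ω| ≤ Θ) : Real.cos Θ * μ.real univ ≤ (∫ ω, exp (-(ψ ω : ℂ) * I) ∂μ).re := by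
  have hre : (∫ ω, exp (-(ψ ω : ℂ) * I) ∂μ).re = ∫ ω, (exp (-(ψ ω : ℂ) * I)).re ∂μ := by
    have h := integral_re (𝕜 := ℂ) (integrable_phase (μ := μ) hψm)
    simpa using h.symm
  rw [hre]
  have hcos : ∀ᵐ ω ∂μ, Real.cos Θ ≤ (exp (-(ψ ω : ℂ) * I)).re := by
    filter_upwards [hψ] with ω hω
    rw [re_phase, ← Real.cos_abs (ψ ω)]
    exact Real.cos_le_cos_of_nonneg_of_le_pi (abs_nonneg _) (hΘ.trans (by linarith [Real.pi_pos])) hω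
  have hint : Integrable (fun ω => (exp (-(ψ ω : ℂ) * I)).re) μ := (integrable_phase hψm).re
  calc Real.cos Θ * μ.real univ = ∫ _ω, Real.cos Θ ∂μ := by rw [integral_const, smul_eq_mul, mul_comm]
    _ ≤ ∫ ω, (exp (-(ψ ω : ℂ) * I)).re ∂μ := integral_mono_ae (integrable_const _) hint hcos

/-- **DENOMINATOR, norm.**  `cos Θ·μ(univ) ≤ ‖∫ e^{−iψ} dμ‖`. [folklore] -/
theorem cos_mul_measure_le_norm_integral_phase {ψ : Ω → ℝ} {Θ : ℝ} (hψm : Measurable ψ) (hΘ : Θ ≤ π / 2)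
    (hψ : ∀ᵐ ω ∂μ, |ψ ω| ≤ Θ) : Real.cos Θ * μ.real univ ≤ ‖∫ ω, exp (-(ψ ω : ℂ) * I) ∂μ‖ :=
  (cos_mul_measure_le_re_integral_phase hψm hΘ hψ).trans (Complex.re_le_norm _)

/-- The denominator does not vanish: `μ ≠ 0` and `Θ < π/2` give `∫ e^{−iψ} dμ ≠ 0`. [folklore] -/
theorem integral_phase_ne_zero {ψ : Ω → ℝ} {Θ : ℝ} (hψm : Measurable ψ) (hΘ0 : 0 ≤ Θ) (hΘ : Θ < π / 2)
    (hψ : ∀ᵐ ω ∂μ, |ψ ω| ≤ Θ) (hμ : μ ≠ 0) : ∫ ω, exp (-(ψ ω : ℂ) * I) ∂μ ≠ 0 := by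
  have hcos : 0 < Real.cos Θ := Real.cos_pos_of_mem_Ioo ⟨by linarith [Real.pi_pos], hΘ⟩
  have hmass : 0 < μ.real univ := by
    rw [measureReal_def, ENNReal.toReal_pos_iff]
    exact ⟨Measure.measure_univ_pos.mpr hμ, measure_lt_top μ _⟩
  have h := cos_mul_measure_le_norm_integral_phase hψm hΘ.le hψ
  intro h0
  rw [h0, norm_zero] at h
  linarith [mul_pos hcos hmass]

/-- **QUASI-POSITIVITY UNDER A BOUNDED PHASE.**  `‖∫ e^{−iψ}•Φ dμ‖ ≤ (N / cos Θ)·‖∫ e^{−iψ} dμ‖` for `‖Φ‖ ≤ N`,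
`|ψ| ≤ Θ` a.e., `0 ≤ N`, `0 ≤ Θ < π/2`.  Reading (skeleton §3d): the normalised expectation of a bounded insertion under a
complex weight whose modulus is a positive weight and whose phase is bounded by the LOCAL total phase `Θ` is at most `1/cos Θ`
times the sup of the insertion — `C_ins ≤ 1/cos Θ ≤ √2` at `Θ ≤ π/4`.  No cluster expansion. [folklore] -/
theorem norm_integral_phase_smul_le_div_mul {ψ : Ω → ℝ} {Φ : Ω → F} {N Θ : ℝ} (hψm : Measurable ψ) (hN : 0 ≤ N)
    (hΘ0 : 0 ≤ Θ) (hΘ : Θ < π / 2) (hψ : ∀ᵐ ω ∂μ, |ψ ω| ≤ Θ) (hΦ : ∀ᵐ ω ∂μ, ‖Φ ω‖ ≤ N) :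
    ‖∫ ω, exp (-(ψ ω : ℂ) * I) • Φ ω ∂μ‖ ≤ N / Real.cos Θ * ‖∫ ω, exp (-(ψ ω : ℂ) * I) ∂μ‖ := by
  have hcos : 0 < Real.cos Θ := Real.cos_pos_of_mem_Ioo ⟨by linarith [Real.pi_pos], hΘ⟩
  have h1 := norm_integral_phase_smul_le (μ := μ) (ψ := ψ) hΦ
  have h2 := cos_mul_measure_le_norm_integral_phase (μ := μ) hψm hΘ.le hψ
  have h3 : μ.real univ ≤ ‖∫ ω, exp (-(ψ ω : ℂ) * I) ∂μ‖ / Real.cos Θ := by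
    rw [le_div_iff₀ hcos, mul_comm]; exact h2
  calc ‖∫ ω, exp (-(ψ ω : ℂ) * I) • Φ ω ∂μ‖ ≤ N * μ.real univ := h1
    _ ≤ N * (‖∫ ω, exp (-(ψ ω : ℂ) * I) ∂μ‖ / Real.cos Θ) := mul_le_mul_of_nonneg_left h3 hN
    _ = N / Real.cos Θ * ‖∫ ω, exp (-(ψ ω : ℂ) * I) ∂μ‖ := by ring

/-- **THE NORMALISED FORM** (`C_ins ≤ 1/cos Θ`): for `μ ≠ 0`,
`‖(∫ e^{−iψ} dμ)⁻¹ • ∫ e^{−iψ}•Φ dμ‖ ≤ N / cos Θ`. [folklore] -/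
theorem norm_phaseMean_le {ψ : Ω → ℝ} {Φ : Ω → F} {N Θ : ℝ} (hψm : Measurable ψ) (hN : 0 ≤ N) (hΘ0 : 0 ≤ Θ)
    (hΘ : Θ < π / 2) (hψ : ∀ᵐ ω ∂μ, |ψ ω| ≤ Θ) (hΦ : ∀ᵐ ω ∂μ, ‖Φ ω‖ ≤ N) (hμ : μ ≠ 0) :
    ‖(∫ ω, exp (-(ψ ω : ℂ) * I) ∂μ)⁻¹ • ∫ ω, exp (-(ψ ω : ℂ) * I) • Φ ω ∂μ‖ ≤ N / Real.cos Θ := by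
  have hZ := integral_phase_ne_zero (μ := μ) hψm hΘ0 hΘ hψ hμ
  have hZpos : 0 < ‖∫ ω, exp (-(ψ ω : ℂ) * I) ∂μ‖ := norm_pos_iff.mpr hZ
  rw [norm_smul, norm_inv, inv_mul_le_iff₀ hZpos, mul_comm]
  exact norm_integral_phase_smul_le_div_mul hψm hN hΘ0 hΘ hψ hΦ

/-- The numeric instance used by the skeleton: at `Θ ≤ π/4`, `1/cos Θ ≤ √2`. [folklore] -/
theorem inv_cos_le_sqrt_two {Θ : ℝ} (hΘ0 : 0 ≤ Θ) (hΘ : Θ ≤ π / 4) : 1 / Real.cos Θ ≤ Real.sqrt 2 := by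
  have hcos4 : Real.cos (π / 4) ≤ Real.cos Θ :=
    Real.cos_le_cos_of_nonneg_of_le_pi hΘ0 (by linarith [Real.pi_pos]) hΘ
  rw [Real.cos_pi_div_four] at hcos4
  have hpos : 0 < Real.sqrt 2 / 2 := by positivity
  have hcos : 0 < Real.cos Θ := lt_of_lt_of_le hpos hcos4
  rw [div_le_iff₀ hcos]
  have hsq : Real.sqrt 2 * Real.sqrt 2 = 2 := Real.mul_self_sqrt (by norm_num)
  nlinarith [hcos4, hsq]

/-! ## §2 (v1.1) Moment booking: averaging a pathwise Schwarz bound against the positive weight -/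

omit [IsFiniteMeasure μ] in
/-- `‖∫ e^{−iψ}•Φ dμ‖ ≤ ∫‖Φ‖ dμ` (the phase has modulus one). [folklore] -/
theorem norm_integral_phase_smul_le_integral_norm {ψ : Ω → ℝ} {Φ : Ω → F} :
    ‖∫ ω, exp (-(ψ ω : ℂ) * I) • Φ ω ∂μ‖ ≤ ∫ ω, ‖Φ ω‖ ∂μ := by
  calc ‖∫ ω, exp (-(ψ ω : ℂ) * I) • Φ ω ∂μ‖ ≤ ∫ ω, ‖exp (-(ψ ω : ℂ) * I) • Φ ω‖ ∂μ := norm_integral_le_integral_norm _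
    _ = ∫ ω, ‖Φ ω‖ ∂μ := by
        congr 1; funext ω; rw [norm_smul, norm_phase, one_mul]

omit [IsFiniteMeasure μ] in
/-- **POINTWISE SCHWARZ, AVERAGED.**  If `‖Φ‖ ≤ (N/R₁)·D` a.e. (reading: the line-Schwarz bound of `NE1pPathwiseBlock` at the
actual configuration, `D` = its displacement from the nearest pure gauge in the units of the disc, `R₁` the disc radius) with `D`
integrable, then `‖∫ e^{−iψ}•Φ dμ‖ ≤ (N/R₁)·∫D dμ`. [folklore] -/
theorem norm_integral_phase_smul_le_of_pointwise {ψ : Ω → ℝ} {Φ : Ω → F} {D : Ω → ℝ} {N R₁ : ℝ}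
    (hD : Integrable D μ) (hΦD : ∀ᵐ ω ∂μ, ‖Φ ω‖ ≤ N / R₁ * D ω) :
    ‖∫ ω, exp (-(ψ ω : ℂ) * I) • Φ ω ∂μ‖ ≤ N / R₁ * ∫ ω, D ω ∂μ := by
  have h1 : ‖∫ ω, exp (-(ψ ω : ℂ) * I) • Φ ω ∂μ‖ ≤ ∫ ω, N / R₁ * D ω ∂μ := by
    refine norm_integral_le_of_norm_le (hD.const_mul _) ?_
    filter_upwards [hΦD] with ω hω
    rw [norm_smul, norm_phase, one_mul]
    exact hω
  rwa [integral_const_mul] at h1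

/-- **THE MOMENT-BOOKED NORMALISED BOUND.**  With `|ψ| ≤ Θ` a.e., `0 ≤ Θ < π/2`, `μ ≠ 0`, and the pointwise bound
`‖Φ‖ ≤ (N/R₁)·D` a.e. (`D` integrable): `‖(∫e^{−iψ}dμ)⁻¹ • ∫e^{−iψ}•Φ dμ‖ ≤ (1/cos Θ)·(N/R₁)·(∫D dμ / μ(univ))` — the
normalised complex expectation is bounded by the FIRST MOMENT of the displacement under the normalised positive weight, times
`1/cos Θ`.  Reading (skeleton v0.12.1 (P-f)): the fluctuation third of the per-step rate is `C_ins·4E_μ[δ̃]/(c₁α_{0,j})` with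
`E_μ[δ̃] = O(g_j)` (moment, printed TYPE) instead of the cut-off `δ_j` (polylog × g_j): no exponent premise. [folklore] -/
theorem norm_phaseMean_le_moment {ψ : Ω → ℝ} {Φ : Ω → F} {D : Ω → ℝ} {N R₁ Θ : ℝ} (hψm : Measurable ψ)
    (hΘ0 : 0 ≤ Θ) (hΘ : Θ < π / 2) (hψ : ∀ᵐ ω ∂μ, |ψ ω| ≤ Θ) (hD : Integrable D μ)
    (hΦD : ∀ᵐ ω ∂μ, ‖Φ ω‖ ≤ N / R₁ * D ω) (hμ : μ ≠ 0) :
    ‖(∫ ω, exp (-(ψ ω : ℂ) * I) ∂μ)⁻¹ • ∫ ω, exp (-(ψ ω : ℂ) * I) • Φ ω ∂μ‖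
      ≤ 1 / Real.cos Θ * (N / R₁) * ((∫ ω, D ω ∂μ) / μ.real univ) := by
  have hcos : 0 < Real.cos Θ := Real.cos_pos_of_mem_Ioo ⟨by linarith [Real.pi_pos], hΘ⟩
  have hZ := integral_phase_ne_zero (μ := μ) hψm hΘ0 hΘ hψ hμ
  have hZpos : 0 < ‖∫ ω, exp (-(ψ ω : ℂ) * I) ∂μ‖ := norm_pos_iff.mpr hZ
  have hmass : 0 < μ.real univ := by
    rw [measureReal_def, ENNReal.toReal_pos_iff]
    exact ⟨Measure.measure_univ_pos.mpr hμ, measure_lt_top μ _⟩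
  have hden := cos_mul_measure_le_norm_integral_phase (μ := μ) hψm hΘ.le hψ
  have hnum := norm_integral_phase_smul_le_of_pointwise (μ := μ) (ψ := ψ) hD hΦD
  -- ∫ D ≥ 0 follows from the pointwise bound only if N/R₁ > 0; we avoid it by working with the product directly
  rw [norm_smul, norm_inv, inv_mul_le_iff₀ hZpos]
  -- goal: ‖∫ phase • Φ‖ ≤ ‖∫ phase‖ * (1/cos Θ * (N/R₁) * (∫D / μ.real univ))
  have hD' : N / R₁ * ∫ ω, D ω ∂μ = (N / R₁) * ((∫ ω, D ω ∂μ) / μ.real univ) * μ.real univ := by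
    field_simp
  calc ‖∫ ω, exp (-(ψ ω : ℂ) * I) • Φ ω ∂μ‖ ≤ N / R₁ * ∫ ω, D ω ∂μ := hnum
    _ = (N / R₁) * ((∫ ω, D ω ∂μ) / μ.real univ) * μ.real univ := hD'
    _ ≤ (N / R₁) * ((∫ ω, D ω ∂μ) / μ.real univ) * (‖∫ ω, exp (-(ψ ω : ℂ) * I) ∂μ‖ / Real.cos Θ) := by
        have hq : 0 ≤ (N / R₁) * ((∫ ω, D ω ∂μ) / μ.real univ) := by
          have h0 : 0 ≤ N / R₁ * ∫ ω, D ω ∂μ := le_trans (norm_nonneg _) hnum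
          have : (N / R₁) * ((∫ ω, D ω ∂μ) / μ.real univ) = (N / R₁ * ∫ ω, D ω ∂μ) / μ.real univ := by ring
          rw [this]; exact div_nonneg h0 hmass.le
        refine mul_le_mul_of_nonneg_left ?_ hq
        rw [le_div_iff₀ hcos, mul_comm]; exact hden
    _ = ‖∫ ω, exp (-(ψ ω : ℂ) * I) ∂μ‖ * (1 / Real.cos Θ * (N / R₁) * ((∫ ω, D ω ∂μ) / μ.real univ)) := by ring

end Summit.QuantumFields.BalabanUV.T4Continuum.NE1pLocalPhase
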